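import Mathlib
import HarnessLib
import Summits.HubbardSuperconductivity.HubbardSuperconductivity.Theorems.KLProgrammeKLRegimeSplitSymInterpProduct
import Summits.HubbardSuperconductivity.HubbardSuperconductivity.Theorems.KLProgrammeKLRegimeSplitSymInterpExact
import Summits.HubbardSuperconductivity.HubbardSuperconductivity.Theorems.KLProgrammeKLRegimeSplitBundleV15
import Summits.HubbardSuperconductivity.HubbardSuperconductivity.Theorems.KLProgrammeKLRegimeSplitFrameDist
import Summits.HubbardSuperconductivity.HubbardSuperconductivity.Theorems.KLProgrammeKLRegimeSplitFrameLemmas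

/-!
# Route `KLProgramme` — GEN-6 two-leg slot (`klPredsV15`): THE MOMENTUM-PRODUCT DOOR for the capped (E3c) responses (part 2)

Cell `gate-hubbard-kl`, seat p1b (g7); asked for by p3 g7 (STATUS 07:13:58Z) for the (E3c)₀ VERTEX response (memo `SCALE0-TWOLEG-EXPORTS.md` v6).
The two-frame response of the separated two-leg output contains momentum products `(K − K')(p_k⃗)·v(k⃗)`; read through `symInterp L` at an
off-lattice Fermi point they are bounded here with the frame difference entering by its SUP NORM `frameDist K K'` only (part 1, `…SymInterpProduct`,
has the harmonic-level facts: product-to-sum, reproduction in the band, the coefficient shift, the support box of `(G∘p)_c`).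

§5 **the door** `abs_eval_symInterp_latticeValues_mul_le`: for `G.degree + R ≤ L/2` and a `D₄`-symmetric real lattice `v`,
   `|(symInterp L (k ↦ G(p_k)·v k)).eval q| ≤ |G(q)|·Σ_{|x̃₀|,|x̃₁| ≤ R} |v_c x| + (Σ_y |(G∘p)_c y|)·Σ_{not both ≤ R} |v_c x|`;
§6 tails by second moments: `Σ_{not both ≤ R} |v_c x| ≤ M₂(v)/(R+2)²`, `M₂(v) = Σ_x (1+|x̃₀|+|x̃₁|)²|v_c x|` (the weights of `…TwoLegMomentsFromGrid`);
§7 **the packaged (E3c) form** `abs_eval_symInterp_frameResponse_mul_le`: `K, K'` of degree `≤ klFrameDeg (nScales β)`, `klBetaMin ≤ β`,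
   `klEngL₃ β U ≤ L` (p2's guard `2^23·16^{n_β} < L`, so `R := L/2 − klFrameDeg (nScales β)` works) ⇒
   `|(symInterp L (k ↦ (K(p_k) − K'(p_k))·v k)).eval q| ≤ frameDist K K' · (M₀(v) + 4·M₂(v))` at EVERY continuum momentum `q`.

How a supplier uses it (the (E3c)₀ capped response `ρ₀` of `frameLipschitzFnTD_zero_of_responses` / `twoLegCoreTD_zero_of_momentumSizes_stub6`):
write the separated two-frame difference `(σ₀^K − K∘p) − (σ₀^{K'} − K'∘p)` as (covariance response) + Σ (momentum products `(K−K')∘p · v_j`) +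
(internal terms `r`); feed each `v_j` here with its coefficient moments `M₀, M₂` (grid bridges give them: `…TwoLegMomentsFromGrid`), and each `r`
to `abs_symInterp_eval_le` with `Σ_y |r_c y|` (there the frame difference sits inside a doubly-summed kernel and enters by `sup |(K−K')_c| ≤ frameDist`).
Caveat (numbers): if a frame itself enters `v` (chains `𝒩_{K−K'}·C·𝒩_{K'}`), `M₂` of a `FrameOK` frame's position kernel is `≍ Gfr₀·|U|·(nScales β+1)`.

Proofs only; nothing about the model is asserted.  References: BGM 2006 §2.4 (2.36) [cite: BenfattoGiulianiMastropietro2006].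
-/

noncomputable section

namespace Summit.HubbardSuperconductivity.HubbardSuperconductivity.Theorems.KLRegimeSplit

set_option linter.dupNamespace false -- summit = problem name (single-conjunct summit), D-0017

open Real Finset Literature.MathematicalPhysics.QuantumLattice Literature.Probability.LatticeModels
open Summit.HubbardSuperconductivity.HubbardSuperconductivity.Theorems.KLProgrammeLegKernels
open Summit.HubbardSuperconductivity.HubbardSuperconductivity.Theorems.EngineV8
open scoped ComplexConjugate

variable (L : ℕ) [NeZero L]

/-! ## §5 The door: the interpolant of (band-limited frame) × (symmetric lattice function) -/

/-- **Core reproduction**: for `G.degree + m, G.degree + n ≤ L/2`, `(symInterp L (G∘p · h_{m,n}∘p)).eval q = G(q)·h_{m,n}(q)`. -/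
theorem eval_symInterp_latticeValues_mul_harmonic_of_le (G : TrigPolyC4v) {m n : ℕ} (hm : G.degree + m ≤ L / 2)
    (hn : G.degree + n ≤ L / 2) (q : Fin 2 → ℝ) :
    (symInterp L (fun k => G.eval (latticeMomentum L k) * TrigPolyC4v.harmonic m n (latticeMomentum L k))).eval q =
      G.eval q * TrigPolyC4v.harmonic m n q := by
  have hdata : (fun k : TorusSite 2 L => G.eval (latticeMomentum L k) * TrigPolyC4v.harmonic m n (latticeMomentum L k)) =
      fun k => ∑ a ∈ range (G.degree + 1), ∑ b ∈ range (G.degree + 1),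
        G.coeff a b * (TrigPolyC4v.harmonic a b (latticeMomentum L k) * TrigPolyC4v.harmonic m n (latticeMomentum L k)) := by
    funext k
    rw [TrigPolyC4v.eval_def, sum_mul]
    refine sum_congr rfl fun a _ => ?_
    rw [sum_mul]
    exact sum_congr rfl fun b _ => mul_assoc _ _ _
  rw [hdata, eval_symInterp_finset_sum L (range (G.degree + 1))
    (fun a k => ∑ b ∈ range (G.degree + 1),
      G.coeff a b * (TrigPolyC4v.harmonic a b (latticeMomentum L k) * TrigPolyC4v.harmonic m n (latticeMomentum L k))),
    TrigPolyC4v.eval_def, sum_mul]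
  refine sum_congr rfl fun a ha => ?_
  rw [eval_symInterp_finset_sum L (range (G.degree + 1))
    (fun b k => G.coeff a b * (TrigPolyC4v.harmonic a b (latticeMomentum L k) * TrigPolyC4v.harmonic m n (latticeMomentum L k))),
    sum_mul]
  refine sum_congr rfl fun b hb => ?_
  have ha' : a ≤ G.degree := Nat.lt_succ_iff.mp (mem_range.mp ha)
  have hb' : b ≤ G.degree := Nat.lt_succ_iff.mp (mem_range.mp hb)
  rw [eval_symInterp_const_mul,
    eval_symInterp_harmonic_mul_harmonic_of_le L (by omega) (by omega) (by omega) (by omega) q, mul_assoc]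

/-- **THE MOMENTUM-PRODUCT DOOR.**  For a frame `G` and a radius `R` with `G.degree + R ≤ L/2`, and a `D₄`-symmetric real lattice function `v`
(even, axis-reflection and swap invariant — the symmetry of every two-leg output), at every continuum momentum `q`:
`|(symInterp L (k ↦ G(p_k)·v k)).eval q| ≤ |G(q)| · Σ_{|x̃₀|,|x̃₁| ≤ R} |v_c x| + (Σ_y |(G∘p)_c y|) · Σ_{not both ≤ R} |v_c x|`.
(Core sites: exact reproduction, §2; tail sites: §3.) -/
theorem abs_eval_symInterp_latticeValues_mul_le (G : TrigPolyC4v) {R : ℕ} (hR : G.degree + R ≤ L / 2)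
    (v : TorusSite 2 L → ℝ) (heven : ∀ k, v (-k) = v k) (hrefl : ∀ k, v ![k 0, -k 1] = v k)
    (hswap : ∀ k, v ![k 1, k 0] = v k) (q : Fin 2 → ℝ) :
    |(symInterp L (fun k => G.eval (latticeMomentum L k) * v k)).eval q| ≤
      |G.eval q| * ∑ x ∈ univ.filter (fun x : TorusSite 2 L => (x 0).valMinAbs.natAbs ≤ R ∧ (x 1).valMinAbs.natAbs ≤ R),
          |torusCosCoeff L v x| +
        (∑ y, |torusCosCoeff L (fun k => G.eval (latticeMomentum L k)) y|) *
          ∑ x ∈ univ.filter (fun x : TorusSite 2 L => ¬((x 0).valMinAbs.natAbs ≤ R ∧ (x 1).valMinAbs.natAbs ≤ R)),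
            |torusCosCoeff L v x| := by
  set H : TorusSite 2 L → (Fin 2 → ℝ) → ℝ := fun x p =>
    TrigPolyC4v.harmonic (x 0).valMinAbs.natAbs (x 1).valMinAbs.natAbs p with hH
  set T : TorusSite 2 L → ℝ := fun x =>
    (symInterp L (fun k => G.eval (latticeMomentum L k) * H x (latticeMomentum L k))).eval q with hT
  have hvrep : ∀ k, v k = ∑ x, torusCosCoeff L v x * H x (latticeMomentum L k) := fun k => by
    rw [← symInterp_eval_latticeMomentum v heven hrefl hswap k, eval_symInterp]
  have hdata : (fun k => G.eval (latticeMomentum L k) * v k) =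
      fun k => ∑ x, torusCosCoeff L v x * (G.eval (latticeMomentum L k) * H x (latticeMomentum L k)) := by
    funext k
    rw [hvrep k, mul_sum]
    exact sum_congr rfl fun x _ => by ring
  have hexp : (symInterp L (fun k => G.eval (latticeMomentum L k) * v k)).eval q = ∑ x, torusCosCoeff L v x * T x := by
    rw [hdata, eval_symInterp_finset_sum L univ
      (fun x k => torusCosCoeff L v x * (G.eval (latticeMomentum L k) * H x (latticeMomentum L k)))]
    exact sum_congr rfl fun x _ => by rw [eval_symInterp_const_mul]
  have hcore : ∀ x : TorusSite 2 L, (x 0).valMinAbs.natAbs ≤ R ∧ (x 1).valMinAbs.natAbs ≤ R → T x = G.eval q * H x q :=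
    fun x hx => eval_symInterp_latticeValues_mul_harmonic_of_le L G (by omega) (by omega) q
  have htail : ∀ x, |T x| ≤ ∑ y, |torusCosCoeff L (fun k => G.eval (latticeMomentum L k)) y| := fun x =>
    abs_eval_symInterp_mul_harmonic_le L (fun k => G.eval (latticeMomentum L k)) _ _ q
  rw [hexp, ← sum_filter_add_sum_filter_not univ
    (fun x : TorusSite 2 L => (x 0).valMinAbs.natAbs ≤ R ∧ (x 1).valMinAbs.natAbs ≤ R)]
  refine (abs_add_le _ _).trans (add_le_add ?_ ?_)
  · calc |∑ x ∈ univ.filter (fun x : TorusSite 2 L => (x 0).valMinAbs.natAbs ≤ R ∧ (x 1).valMinAbs.natAbs ≤ R),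
          torusCosCoeff L v x * T x|
        ≤ ∑ x ∈ univ.filter (fun x : TorusSite 2 L => (x 0).valMinAbs.natAbs ≤ R ∧ (x 1).valMinAbs.natAbs ≤ R),
            |torusCosCoeff L v x * T x| := abs_sum_le_sum_abs _ _
      _ ≤ ∑ x ∈ univ.filter (fun x : TorusSite 2 L => (x 0).valMinAbs.natAbs ≤ R ∧ (x 1).valMinAbs.natAbs ≤ R),
            |G.eval q| * |torusCosCoeff L v x| := by
          refine sum_le_sum fun x hx => ?_
          rw [hcore x (mem_filter.mp hx).2, abs_mul, abs_mul]
          have h1 : |H x q| ≤ 1 := TrigPolyC4v.abs_harmonic_le_one _ _ _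
          have h0 : 0 ≤ |torusCosCoeff L v x| * |G.eval q| := by positivity
          nlinarith
      _ = |G.eval q| * ∑ x ∈ univ.filter
            (fun x : TorusSite 2 L => (x 0).valMinAbs.natAbs ≤ R ∧ (x 1).valMinAbs.natAbs ≤ R), |torusCosCoeff L v x| := by
          rw [mul_sum]
  · calc |∑ x ∈ univ.filter (fun x : TorusSite 2 L => ¬((x 0).valMinAbs.natAbs ≤ R ∧ (x 1).valMinAbs.natAbs ≤ R)),
          torusCosCoeff L v x * T x|
        ≤ ∑ x ∈ univ.filter (fun x : TorusSite 2 L => ¬((x 0).valMinAbs.natAbs ≤ R ∧ (x 1).valMinAbs.natAbs ≤ R)),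
            |torusCosCoeff L v x * T x| := abs_sum_le_sum_abs _ _
      _ ≤ ∑ x ∈ univ.filter (fun x : TorusSite 2 L => ¬((x 0).valMinAbs.natAbs ≤ R ∧ (x 1).valMinAbs.natAbs ≤ R)),
            |torusCosCoeff L v x| * ∑ y, |torusCosCoeff L (fun k => G.eval (latticeMomentum L k)) y| := by
          refine sum_le_sum fun x _ => ?_
          rw [abs_mul]
          exact mul_le_mul_of_nonneg_left (htail x) (abs_nonneg _)
      _ = (∑ y, |torusCosCoeff L (fun k => G.eval (latticeMomentum L k)) y|) *
            ∑ x ∈ univ.filter (fun x : TorusSite 2 L => ¬((x 0).valMinAbs.natAbs ≤ R ∧ (x 1).valMinAbs.natAbs ≤ R)),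
              |torusCosCoeff L v x| := by
          rw [← sum_mul, mul_comm]

/-! ## §6 Tails by second moments -/

/-- **Tail by the second moment**: `Σ_{not both |x̃ᵢ| ≤ R} |v_c x| ≤ M₂/(R+2)²` whenever `Σ_x (1+|x̃₀|+|x̃₁|)²|v_c x| ≤ M₂`. -/
theorem sum_filter_not_abs_torusCosCoeff_le_div (v : TorusSite 2 L → ℝ) (R : ℕ) {M₂ : ℝ}
    (hM₂ : ∑ x : TorusSite 2 L, (1 + ((x 0).valMinAbs.natAbs : ℝ) + ((x 1).valMinAbs.natAbs : ℝ)) ^ 2 *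
      |torusCosCoeff L v x| ≤ M₂) :
    ∑ x ∈ univ.filter (fun x : TorusSite 2 L => ¬((x 0).valMinAbs.natAbs ≤ R ∧ (x 1).valMinAbs.natAbs ≤ R)),
      |torusCosCoeff L v x| ≤ M₂ / ((R : ℝ) + 2) ^ 2 := by
  have hpos : (0 : ℝ) < ((R : ℝ) + 2) ^ 2 := by positivity
  rw [le_div_iff₀ hpos, sum_mul]
  calc ∑ x ∈ univ.filter (fun x : TorusSite 2 L => ¬((x 0).valMinAbs.natAbs ≤ R ∧ (x 1).valMinAbs.natAbs ≤ R)),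
        |torusCosCoeff L v x| * ((R : ℝ) + 2) ^ 2
      ≤ ∑ x ∈ univ.filter (fun x : TorusSite 2 L => ¬((x 0).valMinAbs.natAbs ≤ R ∧ (x 1).valMinAbs.natAbs ≤ R)),
          (1 + ((x 0).valMinAbs.natAbs : ℝ) + ((x 1).valMinAbs.natAbs : ℝ)) ^ 2 * |torusCosCoeff L v x| := by
        refine sum_le_sum fun x hx => ?_
        have hx' := (mem_filter.mp hx).2
        have hw : (R : ℝ) + 2 ≤ 1 + ((x 0).valMinAbs.natAbs : ℝ) + ((x 1).valMinAbs.natAbs : ℝ) := by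
          have h0 : (0 : ℝ) ≤ ((x 0).valMinAbs.natAbs : ℝ) := Nat.cast_nonneg _
          have h1 : (0 : ℝ) ≤ ((x 1).valMinAbs.natAbs : ℝ) := Nat.cast_nonneg _
          rcases not_and_or.mp hx' with h | h
          · have : (R : ℝ) + 1 ≤ ((x 0).valMinAbs.natAbs : ℝ) := by exact_mod_cast Nat.lt_of_not_le h
            linarith
          · have : (R : ℝ) + 1 ≤ ((x 1).valMinAbs.natAbs : ℝ) := by exact_mod_cast Nat.lt_of_not_le h
            linarith
        rw [mul_comm]
        exact mul_le_mul_of_nonneg_right (pow_le_pow_left₀ (by positivity) hw 2) (abs_nonneg _)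
    _ ≤ ∑ x : TorusSite 2 L, (1 + ((x 0).valMinAbs.natAbs : ℝ) + ((x 1).valMinAbs.natAbs : ℝ)) ^ 2 *
          |torusCosCoeff L v x| :=
        sum_le_univ_sum_of_nonneg fun x => by positivity
    _ ≤ M₂ := hM₂

/-! ## §7 The packaged (E3c) form: frame differences under the cap, at the engine's volumes -/

/-- **THE (E3c) DOOR.**  For frames `K, K'` within the cap `klFrameDeg (nScales β)` (both `FrameOKDeg` classes of the gen-6 bundle give this:
`FrameOKDeg.degree_le`, `FrameOKDeg.degree_le_nScales`), `klBetaMin ≤ β`, an engine volume `klEngL₃ β U ≤ L`, and a `D₄`-symmetric real lattice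
function `v` with coefficient moments `Σ_x |v_c x| ≤ M₀`, `Σ_x (1+|x̃₀|+|x̃₁|)²|v_c x| ≤ M₂`:
`|(symInterp L (k ↦ (K(p_k) − K'(p_k))·v k)).eval q| ≤ frameDist K K' · (M₀ + 4·M₂)` at EVERY continuum momentum `q` — the frame difference enters
by its sup norm only. -/
theorem abs_eval_symInterp_frameResponse_mul_le {β U : ℝ} (hβ : klBetaMin ≤ β) (hL : klEngL₃ β U ≤ L)
    {K K' : TrigPolyC4v} (hK : K.degree ≤ klFrameDeg (nScales β)) (hK' : K'.degree ≤ klFrameDeg (nScales β))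
    (v : TorusSite 2 L → ℝ) (heven : ∀ k, v (-k) = v k) (hrefl : ∀ k, v ![k 0, -k 1] = v k)
    (hswap : ∀ k, v ![k 1, k 0] = v k) {M₀ M₂ : ℝ} (hM₀ : ∑ x, |torusCosCoeff L v x| ≤ M₀)
    (hM₂ : ∑ x : TorusSite 2 L, (1 + ((x 0).valMinAbs.natAbs : ℝ) + ((x 1).valMinAbs.natAbs : ℝ)) ^ 2 *
      |torusCosCoeff L v x| ≤ M₂)
    (q : Fin 2 → ℝ) :
    |(symInterp L (fun k => (K.eval (latticeMomentum L k) - K'.eval (latticeMomentum L k)) * v k)).eval q| ≤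
      frameDist K K' * (M₀ + 4 * M₂) := by
  set D := klFrameDeg (nScales β) with hD
  have h4 : 4 * D < L := by
    have h := two_pow_23_mul_sixteen_pow_nScales_lt_of_klEngL₃_le (U := U) hβ hL
    have e : 4 * D = 2 ^ 23 * 16 ^ nScales β := by rw [hD]; unfold klFrameDeg; ring
    rw [e]; exact h
  set G := fsub K K' with hG
  have hGdeg : G.degree ≤ D := max_le hK hK'
  have hGeval : ∀ p, G.eval p = K.eval p - K'.eval p := eval_fsub K K'
  set R := L / 2 - D with hR
  have hDR : G.degree + R ≤ L / 2 := by omega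
  have hdata : (fun k => (K.eval (latticeMomentum L k) - K'.eval (latticeMomentum L k)) * v k) =
      fun k => G.eval (latticeMomentum L k) * v k := by
    funext k; rw [hGeval]
  rw [hdata]
  have hdoor := abs_eval_symInterp_latticeValues_mul_le L G hDR v heven hrefl hswap q
  have hfd : 0 ≤ frameDist K K' := frameDist_nonneg K K'
  have hs : ∀ k : TorusSite 2 L, |G.eval (latticeMomentum L k)| ≤ frameDist K K' := fun k => by
    rw [hGeval]; exact abs_eval_sub_le_frameDist K K' _
  have hGq : |G.eval q| ≤ frameDist K K' := by rw [hGeval]; exact abs_eval_sub_le_frameDist K K' q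
  have hC : ∑ y, |torusCosCoeff L (fun k => G.eval (latticeMomentum L k)) y| ≤ (2 * (G.degree : ℝ) + 1) ^ 2 * frameDist K K' :=
    sum_abs_torusCosCoeff_latticeValues_le L G hs
  have hcore : ∑ x ∈ univ.filter (fun x : TorusSite 2 L => (x 0).valMinAbs.natAbs ≤ R ∧ (x 1).valMinAbs.natAbs ≤ R),
      |torusCosCoeff L v x| ≤ M₀ :=
    (sum_le_univ_sum_of_nonneg fun x => abs_nonneg _).trans hM₀
  have htail := sum_filter_not_abs_torusCosCoeff_le_div L v R hM₂
  have hM2 : 0 ≤ M₂ := (sum_nonneg fun x _ => by positivity).trans hM₂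
  have hpos : (0 : ℝ) < ((R : ℝ) + 2) ^ 2 := by positivity
  have hnat : 2 * G.degree + 1 ≤ 2 * (R + 2) := by omega
  have hratio : (2 * (G.degree : ℝ) + 1) ^ 2 ≤ 4 * ((R : ℝ) + 2) ^ 2 := by
    have h1 : (2 * (G.degree : ℝ) + 1) ≤ 2 * ((R : ℝ) + 2) := by exact_mod_cast hnat
    calc (2 * (G.degree : ℝ) + 1) ^ 2 ≤ (2 * ((R : ℝ) + 2)) ^ 2 := pow_le_pow_left₀ (by positivity) h1 2
      _ = 4 * ((R : ℝ) + 2) ^ 2 := by ring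
  have hq : (2 * (G.degree : ℝ) + 1) ^ 2 / ((R : ℝ) + 2) ^ 2 ≤ 4 := by rw [div_le_iff₀ hpos]; exact hratio
  have hA : |G.eval q| * ∑ x ∈ univ.filter
      (fun x : TorusSite 2 L => (x 0).valMinAbs.natAbs ≤ R ∧ (x 1).valMinAbs.natAbs ≤ R), |torusCosCoeff L v x| ≤
      frameDist K K' * M₀ :=
    mul_le_mul hGq hcore (sum_nonneg fun x _ => abs_nonneg _) hfd
  have hB : (∑ y, |torusCosCoeff L (fun k => G.eval (latticeMomentum L k)) y|) *
      ∑ x ∈ univ.filter (fun x : TorusSite 2 L => ¬((x 0).valMinAbs.natAbs ≤ R ∧ (x 1).valMinAbs.natAbs ≤ R)),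
        |torusCosCoeff L v x| ≤ ((2 * (G.degree : ℝ) + 1) ^ 2 * frameDist K K') * (M₂ / ((R : ℝ) + 2) ^ 2) :=
    mul_le_mul hC htail (sum_nonneg fun x _ => abs_nonneg _) (by positivity)
  have hB' : ((2 * (G.degree : ℝ) + 1) ^ 2 * frameDist K K') * (M₂ / ((R : ℝ) + 2) ^ 2) =
      frameDist K K' * M₂ * ((2 * (G.degree : ℝ) + 1) ^ 2 / ((R : ℝ) + 2) ^ 2) := by ring
  have hB'' : frameDist K K' * M₂ * ((2 * (G.degree : ℝ) + 1) ^ 2 / ((R : ℝ) + 2) ^ 2) ≤ frameDist K K' * M₂ * 4 :=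
    mul_le_mul_of_nonneg_left hq (mul_nonneg hfd hM2)
  calc _ ≤ _ := hdoor
    _ ≤ frameDist K K' * M₀ + frameDist K K' * M₂ * 4 := add_le_add hA (hB.trans (by rw [hB']; exact hB''))
    _ = frameDist K K' * (M₀ + 4 * M₂) := by ring

end Summit.HubbardSuperconductivity.HubbardSuperconductivity.Theorems.KLRegimeSplit

end
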